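import Summits.CriticalPhenomena.SAWScalingLimit.Theses.SAWPoincareChain

/-!
# Birth skeleton (`Lines/birth.lean`) for the crux `SAWPoincareChain.ObstacleIsMetric` (stmt-CriticalPhenomena-7555)

Route `route-CriticalPhenomena-SAWPoincareChain`, sub-problem `SAWScalingLimit`; skeleton registrar
(planner one-shot, 2026-08-17).  The crux (route decl, FIXED, concluded BY NAME below):
for every `Q : ℝ → ChordalFamily` with the ChainLaw property `H(Q)` (eventually in `t → 0⁺`: chordal,
EXACTLY conformally covariant, and `Q t 𝔻` = weak limit of the normalised Poincaré-chain approximants),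
every probability subsequential limit `μ` of `t ↦ Q t 𝔻`, every hull subdomain `U` of `𝔻 = (unit disc; 1, −1)`
and every conformal `g : 𝔻 → U` fixing `±1` with continuous extension `Φ`:
`Φ_*μ (T) · μ {γ ⊆ Ū} = μ (T ∩ {γ ⊆ Ū})` for all measurable `T`.

## The line: "obstacle = metric" at finite `t`, then a soft passage to the limit

Write `P_t := Q t 𝔻`, `C_U := {γ ⊆ Ū} = rangeSubset (closure U)` (closed), `K := closure (𝔻 ∖ U)` (the hull
with its rim) and `O := rangeSubset Kᶜ` (open).  At finite `t`:
* conditioning `P_t` on `C_U` IS the chain of `U` run with `𝔻`'s Poincaré metric (hereditary hard core);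
* `Q t U` IS the chain of `U` run with `U`'s own metric, and `Q t U = Φ_* P_t` by exact covariance (part of `H(Q)`).

So the crux says `lim (obstacle carved out) = lim (metric opened up)`, and the skeleton cuts it into

* `stub_wallLayerNeutrality` (S1, the analytic heart, XL / open): for every hull subdomain `U` of `𝔻` and every
  bounded continuous `f`, `∫ f d(Q t U) · P_t(C_U) − ∫_{C_U} f dP_t → 0` as `t → 0⁺` — the two chains of `U`
  (own metric vs. ambient metric + hard wall) are weakly asymptotic; the wall layer where the two Poincaré
  metrics differ carries no macroscopic effect.  Stated WITHOUT `Φ`: the transported law enters only through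
  covariance, in the composition.  Why it might fail: an effective wall attraction past the adsorption
  threshold (the crux's own failure mode); MC on the shadow `q_t(d) → 1 − tanh^{5/4} d` decides.
* `stub_noWallPinning` (S2, L): every probability subsequential limit `μ` of `P_t` gives zero mass to GRAZING,
  `μ (C_U ∖ O) = 0`: a limit curve that stays in `Ū` does not touch the hull `K` (incl. its two rim points on
  the circle).  This is the regularity that lets the closed conditioning event pass to the limit; its failure
  (wall pinning of the limit) is again the adsorption scenario, now for the unconditioned law.
  (`U = 𝔻`: `K = ∅`, trivial — consistent with the refuter's remark that the crux at `U = 𝔻` is Möbius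
  invariance, which the composition gets from covariance alone.)
* `stub_limitPassage` (S3, M, pure measure theory on `CurveClass ℂ`, provable now): for ANY family
  `P : ℝ → Measure (CurveClass ℂ)` eventually probability and carried by `{γ ⊆ cl D}`, any continuous `Φ`, any hull
  subdomain `U` of `D`: the finite-`t` weak identity (with `Φ_* P_t`) + a probability subsequential limit `μ`
  (`IsSubseqLimitLaw` of the identity variable, i.e. `P (s n) → μ` weakly along `s n → 0⁺`) + non-grazing
  `μ (C_U ∖ rangeSubset (closure (D ∖ U))ᶜ) = 0` ⟹ `Φ_*μ (T) · μ (C_U) = μ (T ∩ C_U)` for all measurable `T`.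
  Proof sketch (for the prover): along `s n`, (1) `∫ f dΦ_*P_n = ∫ f∘(map Φ) dP_n → ∫ f dΦ_*μ`
  (`CurveClass.map Φ` continuous); (2) `P_n(C_U) → μ(C_U)`: `limsup ≤` (closed set), and
  `P_n(C_U) ≥ P_n(O ∩ C_D) = P_n(O)` since `cl D ∖ K ⊆ cl U`, `liminf P_n(O) ≥ μ(O) ≥ μ(C_U ∩ O) = μ(C_U)`;
  (3) likewise `∫_{C_U} f dP_n → ∫_{C_U} f dμ` for `0 ≤ f ∈ C_b` (usc upper bound on the closed set, lsc lower
  bound through `O`), then all `f` by adding a constant; (4) the finite measures `μ(C_U) • Φ_*μ` and `μ|_{C_U}`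
  have equal integrals of every bounded continuous function, hence coincide
  (`HasOuterApproxClosed` on the metric space `CurveClass ℂ`), and `μ|_{C_U} T = μ (T ∩ C_U)`.

`ObstacleIsMetric_of : S1 → S2 → S3 → ObstacleIsMetric` is a real proof: it extracts from `H(Q)` the
eventual chordality (probability + carried by `cl 𝔻`) and the exact covariance `Q t U = Φ_* (Q t 𝔻)` (using the
hull subdomain's marked points `U.pt i = 𝔻.pt i` to feed the crux's boundary values of `g` into
`IsConformallyCovariant`), transports S1 along that eventual equality (`Tendsto.congr'`), and applies S3 with
`P := fun t ↦ Q t 𝔻`, the non-grazing input being S2.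

Disproof used: none relevant (the crux has no `Disproof.lean` / Negative lemmas yet: `ledger crux ls` showed no
workfiles on 2026-08-17).  Dead lines: none recorded for this crux.
Unproved obligations: exactly the three `stub_*` bodies; nothing else (the composition is kernel-checked).
-/

open MeasureTheory Filter Set
open scoped MeasureTheory ENNReal NNReal Topology BoundedContinuousFunction

namespace Summit.CriticalPhenomena.SAWScalingLimit.Cruxes.ObstacleIsMetric.Birth

/-! ## Stub signatures (`Sig.stub_<name> : Prop`); the registered obligations below restate them BY NAME,
as the skeleton audit (`#h21_check_skeleton`) requires (`theorem stub_<name> : Sig.stub_<name>`, placeholder proof). -/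

namespace Sig

/-- **S1 — wall-layer neutrality (finite-`t` weak "obstacle = metric"; size XL, the research core).** For every
`Q` with the ChainLaw property, every hull subdomain `U` of the unit disc and every bounded continuous `f`, the chain
of `U` in its own metric (`Q t U`) and the chain of `𝔻` restricted to `C_U = {γ ⊆ Ū}` are weakly asymptotic as
`t → 0⁺`: `∫ f d(Q t U) · (Q t 𝔻)(C_U) − ∫_{C_U} f d(Q t 𝔻) → 0`.  (At `U = 𝔻` it is trivially true: `Q t 𝔻` is carried
by `C_𝔻`.)  Why it might fail: wall attraction past the adsorption threshold — the crux's own failure mode. -/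
def stub_wallLayerNeutrality : Prop :=
  ∀ Q : ℝ → Literature.Probability.RandomPlanarGeometry.ChordalFamily, (∀ᶠ t in nhdsWithin (0:ℝ) (Set.Ioi 0), (Q t).IsChordal ∧ (Q t).IsConformallyCovariant ∧ Literature.Probability.RandomPlanarGeometry.TendstoLaw (fun (_ : ℝ) (x : Literature.Probability.RandomPlanarGeometry.CurveClass ℂ) => x) (fun r => (fun S : MeasureTheory.Measure (Literature.Probability.RandomPlanarGeometry.CurveClass ℂ) => (S Set.univ)⁻¹ • S) ((fun (xc t ρ : ℝ) (pos : (ℕ → ℝ) → ℕ → ℂ) => MeasureTheory.Measure.sum fun n : ℕ => ENNReal.ofReal ((xc / (2 * Real.pi)) ^ n) • ((MeasureTheory.volume.restrict {θ : Fin n → ℝ | (∀ k, θ k ∈ Set.Ico (0:ℝ) (2 * Real.pi)) ∧ (∀ i j : ℕ, i + 2 ≤ j → j ≤ n → t * ‖1 - (starRingEnd ℂ) (pos (fun k => if h : k < n then θ ⟨k, h⟩ else 0) i) * pos (fun k => if h : k < n then θ ⟨k, h⟩ else 0) j‖ < ‖pos (fun k => if h : k < n then θ ⟨k, h⟩ else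 0) i - pos (fun k => if h : k < n then θ ⟨k, h⟩ else 0) j‖) ∧ 2 * ‖pos (fun k => if h : k < n then θ ⟨k, h⟩ else 0) n + ↑ρ‖ ≤ ‖1 + ↑ρ * pos (fun k => if h : k < n then θ ⟨k, h⟩ else 0) n‖}).map (fun θ => Literature.Probability.RandomPlanarGeometry.CurveClass.mk (⟨Literature.Probability.LatticeModels.polyline ((List.range (n + 1)).map (pos (fun k => if h : k < n then θ ⟨k, h⟩ else 0)))⟩ : Literature.Probability.RandomPlanarGeometry.Curve ℂ)))) ((⨅ n : ℕ, ((MeasureTheory.volume {θ : Fin (n + 1) → ℝ | (∀ k, θ k ∈ Set.Ico (0:ℝ) (2 * Real.pi)) ∧ ∀ i j : ℕ, i + 2 ≤ j → j ≤ n + 1 → 1 < ‖(List.range i).foldl (fun (z : ℂ) (m : ℕ) => z + Complex.exp (↑(if h : m < n + 1 then θ ⟨m, h⟩ else 0) * Complex.I)) 0 - (List.range j).foldl (fun (z : ℂ) (m : ℕ) => z + Complex.exp (↑(if h : m < n + 1 then θ ⟨m, h⟩ else 0) * Complex.I)) 0‖}).toReal / (2 * Real.pi) ^ (n + 1)) ^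 (1 / ((n : ℝ) + 1)))⁻¹) t (1 - r) (fun θ k => (List.range k).foldl (fun (z : ℂ) (j : ℕ) => (z + ↑t * Complex.exp (↑(θ j) * Complex.I)) / (1 + (starRingEnd ℂ) z * (↑t * Complex.exp (↑(θ j) * Complex.I)))) (↑(1 - r) : ℂ)))) id (Q t Literature.Probability.RandomPlanarGeometry.DobrushinDomain.unitDisc)) → ∀ U : Literature.Probability.RandomPlanarGeometry.DobrushinDomain, Literature.Probability.RandomPlanarGeometry.MarkedDomain.IsHullSubdomain Literature.Probability.RandomPlanarGeometry.DobrushinDomain.unitDisc U → ∀ f : BoundedContinuousFunction (Literature.Probability.RandomPlanarGeometry.CurveClass ℂ) ℝ, Filter.Tendsto (fun t : ℝ => (∫ x, f x ∂(Q t U)) * ((Q t Literature.Probability.RandomPlanarGeometry.DobrushinDomain.unitDisc) (Literature.Probability.RandomPlanarGeometry.CurveClass.rangeSubset (closure U.carrier))).toReal - ∫ x in Literature.Probability.RandomPlanarGeometry.CurveClass.rangeSubset (closure U.carrier), f x ∂(Q t Literature.Probability.RandomPlanarGeometry.DobrushinDomain.unitDisc)) (nhdsWithin (0:ℝ) (Set.Ioi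 0)) (nhds 0)

/-- **S2 — no wall pinning (non-grazing of subsequential limits; size L).** For every `Q` with the ChainLaw
property and every probability subsequential limit `μ` of the disc laws, a limit curve staying in `Ū` does not touch
the hull `K = closure (𝔻 ∖ U)`: `μ (C_U ∖ rangeSubset Kᶜ) = 0`.  (At `U = 𝔻`: `K = ∅`, trivially true.)  Why it might
fail: wall pinning of the unconditioned limit (adsorption again), or a degenerate (geodesic-like) limit. -/
def stub_noWallPinning : Prop :=
  ∀ Q : ℝ → Literature.Probability.RandomPlanarGeometry.ChordalFamily, (∀ᶠ t in nhdsWithin (0:ℝ) (Set.Ioi 0), (Q t).IsChordal ∧ (Q t).IsConformallyCovariant ∧ Literature.Probability.RandomPlanarGeometry.TendstoLaw (fun (_ : ℝ) (x : Literature.Probability.RandomPlanarGeometry.CurveClass ℂ) => x) (fun r => (fun S : MeasureTheory.Measure (Literature.Probability.RandomPlanarGeometry.CurveClass ℂ) => (S Set.univ)⁻¹ • S) ((fun (xc t ρ : ℝ) (pos : (ℕ → ℝ) → ℕ → ℂ) => MeasureTheory.Measure.sum fun n : ℕ => ENNReal.ofReal ((xc / (2 * Real.pi)) ^ n) • ((MeasureTheory.volume.restrict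 {θ : Fin n → ℝ | (∀ k, θ k ∈ Set.Ico (0:ℝ) (2 * Real.pi)) ∧ (∀ i j : ℕ, i + 2 ≤ j → j ≤ n → t * ‖1 - (starRingEnd ℂ) (pos (fun k => if h : k < n then θ ⟨k, h⟩ else 0) i) * pos (fun k => if h : k < n then θ ⟨k, h⟩ else 0) j‖ < ‖pos (fun k => if h : k < n then θ ⟨k, h⟩ else 0) i - pos (fun k => if h : k < n then θ ⟨k, h⟩ else 0) j‖) ∧ 2 * ‖pos (fun k => if h : k < n then θ ⟨k, h⟩ else 0) n + ↑ρ‖ ≤ ‖1 + ↑ρ * pos (fun k => if h : k < n then θ ⟨k, h⟩ else 0) n‖}).map (fun θ => Literature.Probability.RandomPlanarGeometry.CurveClass.mk (⟨Literature.Probability.LatticeModels.polyline ((List.range (n + 1)).map (pos (fun k => if h : k < n then θ ⟨k, h⟩ else 0)))⟩ : Literature.Probability.RandomPlanarGeometry.Curve ℂ)))) ((⨅ n : ℕ, ((MeasureTheory.volume {θ : Fin (n + 1) → ℝ | (∀ k, θ k ∈ Set.Ico (0:ℝ) (2 * Real.pi)) ∧ ∀ i j : ℕ, i + 2 ≤ j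 → j ≤ n + 1 → 1 < ‖(List.range i).foldl (fun (z : ℂ) (m : ℕ) => z + Complex.exp (↑(if h : m < n + 1 then θ ⟨m, h⟩ else 0) * Complex.I)) 0 - (List.range j).foldl (fun (z : ℂ) (m : ℕ) => z + Complex.exp (↑(if h : m < n + 1 then θ ⟨m, h⟩ else 0) * Complex.I)) 0‖}).toReal / (2 * Real.pi) ^ (n + 1)) ^ (1 / ((n : ℝ) + 1)))⁻¹) t (1 - r) (fun θ k => (List.range k).foldl (fun (z : ℂ) (j : ℕ) => (z + ↑t * Complex.exp (↑(θ j) * Complex.I)) / (1 + (starRingEnd ℂ) z * (↑t * Complex.exp (↑(θ j) * Complex.I)))) (↑(1 - r) : ℂ)))) id (Q t Literature.Probability.RandomPlanarGeometry.DobrushinDomain.unitDisc)) → ∀ μ : MeasureTheory.Measure (Literature.Probability.RandomPlanarGeometry.CurveClass ℂ), MeasureTheory.IsProbabilityMeasure μ → Literature.Probability.RandomPlanarGeometry.IsSubseqLimitLaw (fun (_ : ℝ) (x : Literature.Probability.RandomPlanarGeometry.CurveClass ℂ) => x) (fun t => Q t Literature.Probability.RandomPlanarGeometry.DobrushinDomain.unitDisc)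 μ → ∀ U : Literature.Probability.RandomPlanarGeometry.DobrushinDomain, Literature.Probability.RandomPlanarGeometry.MarkedDomain.IsHullSubdomain Literature.Probability.RandomPlanarGeometry.DobrushinDomain.unitDisc U → μ (Literature.Probability.RandomPlanarGeometry.CurveClass.rangeSubset (closure U.carrier) \ Literature.Probability.RandomPlanarGeometry.CurveClass.rangeSubset ((closure (Literature.Probability.RandomPlanarGeometry.DobrushinDomain.unitDisc.carrier \ U.carrier))ᶜ)) = 0

/-- **S3 — limit passage (soft; size M, provable now).** For ANY family `P : ℝ → Measure (CurveClass ℂ)` eventually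
probability and carried by `{γ ⊆ cl D}`, any continuous `Φ`, any hull subdomain `U` of `D`: the finite-`t` weak identity
(with `Φ_* P_t`) + a probability subsequential limit `μ` + non-grazing `μ (C_U ∖ rangeSubset (closure (D ∖ U))ᶜ) = 0`
⟹ `Φ_*μ (T) · μ (C_U) = μ (T ∩ C_U)` for all measurable `T` (portmanteau with a one-sided continuity set, then
identification of finite Borel measures on the metric space `CurveClass ℂ` by bounded continuous integrands). -/
def stub_limitPassage : Prop :=
  ∀ (P : ℝ → MeasureTheory.Measure (Literature.Probability.RandomPlanarGeometry.CurveClass ℂ)) (Φ : C(ℂ, ℂ)) (D U : Literature.Probability.RandomPlanarGeometry.DobrushinDomain), Literature.Probability.RandomPlanarGeometry.MarkedDomain.IsHullSubdomain D U → (∀ᶠ t in nhdsWithin (0:ℝ) (Set.Ioi 0), MeasureTheory.IsProbabilityMeasure (P t) ∧ ∀ᵐ γ ∂(P t), γ.range ⊆ closure D.carrier) → (∀ f : BoundedContinuousFunction (Literature.Probability.RandomPlanarGeometry.CurveClass ℂ) ℝ, Filter.Tendsto (fun t : ℝ => (∫ x, f x ∂((P t).map (Literature.Probability.RandomPlanarGeometry.CurveClass.map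 Φ))) * ((P t) (Literature.Probability.RandomPlanarGeometry.CurveClass.rangeSubset (closure U.carrier))).toReal - ∫ x in Literature.Probability.RandomPlanarGeometry.CurveClass.rangeSubset (closure U.carrier), f x ∂(P t)) (nhdsWithin (0:ℝ) (Set.Ioi 0)) (nhds 0)) → ∀ μ : MeasureTheory.Measure (Literature.Probability.RandomPlanarGeometry.CurveClass ℂ), MeasureTheory.IsProbabilityMeasure μ → Literature.Probability.RandomPlanarGeometry.IsSubseqLimitLaw (fun (_ : ℝ) (x : Literature.Probability.RandomPlanarGeometry.CurveClass ℂ) => x) P μ → μ (Literature.Probability.RandomPlanarGeometry.CurveClass.rangeSubset (closure U.carrier) \ Literature.Probability.RandomPlanarGeometry.CurveClass.rangeSubset ((closure (D.carrier \ U.carrier))ᶜ)) = 0 → ∀ T : Set (Literature.Probability.RandomPlanarGeometry.CurveClass ℂ), MeasurableSet T → μ.map (Literature.Probability.RandomPlanarGeometry.CurveClass.map Φ) T * μ (Literature.Probability.RandomPlanarGeometry.CurveClass.rangeSubset (closure U.carrier)) = μ (T ∩ Literature.Probability.RandomPlanarGeometry.CurveClass.rangeSubset (closure U.carrier))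

end Sig

/-! ## The registered stubs (the ONLY declarations with a placeholder proof) -/

/-- Registered stub S1 — wall-layer neutrality (XL, hardest). Statement: `Sig.stub_wallLayerNeutrality`. -/
theorem stub_wallLayerNeutrality : Sig.stub_wallLayerNeutrality := by
  sorry

/-- Registered stub S2 — no wall pinning (L). Statement: `Sig.stub_noWallPinning`. -/
theorem stub_noWallPinning : Sig.stub_noWallPinning := by
  sorry

/-- Registered stub S3 — limit passage (M, provable now). Statement: `Sig.stub_limitPassage`. -/
theorem stub_limitPassage : Sig.stub_limitPassage := by
  sorry

/-! ## Composition (kernel-checked, no placeholders): the stubs imply the crux BY NAME -/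

/-- **Composition.** `Sig.stub_wallLayerNeutrality → Sig.stub_noWallPinning → Sig.stub_limitPassage →
SAWPoincareChain.ObstacleIsMetric` (named hypotheses, conclusion = the route decl; covariance bookkeeping from `H(Q)` + `Tendsto.congr'` + S3 at `P := fun t ↦ Q t 𝔻`). -/
theorem ObstacleIsMetric_of (h1 : Sig.stub_wallLayerNeutrality) (h2 : Sig.stub_noWallPinning)
    (h3 : Sig.stub_limitPassage) :
    Summit.CriticalPhenomena.SAWScalingLimit.Theses.SAWPoincareChain.ObstacleIsMetric := by
  intro Q hQ μ hμ hsub U hU g Φ hg0 hg1 hΦ T hT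
  have hcar : ∀ᶠ t in nhdsWithin (0:ℝ) (Set.Ioi 0),
      MeasureTheory.IsProbabilityMeasure (Q t Literature.Probability.RandomPlanarGeometry.DobrushinDomain.unitDisc) ∧
        ∀ᵐ γ ∂(Q t Literature.Probability.RandomPlanarGeometry.DobrushinDomain.unitDisc), γ.range ⊆ closure Literature.Probability.RandomPlanarGeometry.DobrushinDomain.unitDisc.carrier :=
    hQ.mono fun t ht => ⟨(ht.1 Literature.Probability.RandomPlanarGeometry.DobrushinDomain.unitDisc).1, (ht.1 Literature.Probability.RandomPlanarGeometry.DobrushinDomain.unitDisc).2.mono fun γ hγ => hγ.2.2⟩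
  have hb0 : g.HasBoundaryValue (Literature.Probability.RandomPlanarGeometry.DobrushinDomain.unitDisc.pt 0) (U.pt 0) := by
    rw [hU.pt_zero_eq]; exact hg0
  have hb1 : g.HasBoundaryValue (Literature.Probability.RandomPlanarGeometry.DobrushinDomain.unitDisc.pt 1) (U.pt 1) := by
    rw [hU.pt_one_eq]; exact hg1
  have hcov : ∀ᶠ t in nhdsWithin (0:ℝ) (Set.Ioi 0),
      Q t U = (Q t Literature.Probability.RandomPlanarGeometry.DobrushinDomain.unitDisc).map (Literature.Probability.RandomPlanarGeometry.CurveClass.map Φ) :=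
    hQ.mono fun t ht => ht.2.1 Literature.Probability.RandomPlanarGeometry.DobrushinDomain.unitDisc U g Φ hb0 hb1 hΦ
  have hW : ∀ f : BoundedContinuousFunction (Literature.Probability.RandomPlanarGeometry.CurveClass ℂ) ℝ, Filter.Tendsto (fun t : ℝ =>
      (∫ x, f x ∂((Q t Literature.Probability.RandomPlanarGeometry.DobrushinDomain.unitDisc).map (Literature.Probability.RandomPlanarGeometry.CurveClass.map Φ))) *
          ((Q t Literature.Probability.RandomPlanarGeometry.DobrushinDomain.unitDisc) (Literature.Probability.RandomPlanarGeometry.CurveClass.rangeSubset (closure U.carrier))).toReal -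
        ∫ x in Literature.Probability.RandomPlanarGeometry.CurveClass.rangeSubset (closure U.carrier), f x ∂(Q t Literature.Probability.RandomPlanarGeometry.DobrushinDomain.unitDisc))
      (nhdsWithin (0:ℝ) (Set.Ioi 0)) (nhds 0) :=
    fun f => (h1 Q hQ U hU f).congr' (hcov.mono fun t ht => by simp only [ht])
  exact h3 (fun t => Q t Literature.Probability.RandomPlanarGeometry.DobrushinDomain.unitDisc) Φ Literature.Probability.RandomPlanarGeometry.DobrushinDomain.unitDisc U hU hcar hW μ hμ hsub (h2 Q hQ μ hμ hsub U hU) T hT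

/-- Wiring check (an `example`, so that `ObstacleIsMetric_of` stays the only theorem concluding the crux):
the registered stubs feed the composition as stated. -/
example : Summit.CriticalPhenomena.SAWScalingLimit.Theses.SAWPoincareChain.ObstacleIsMetric :=
  ObstacleIsMetric_of stub_wallLayerNeutrality stub_noWallPinning stub_limitPassage

end Summit.CriticalPhenomena.SAWScalingLimit.Cruxes.ObstacleIsMetric.Birth
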